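import Summits.BirchSwinnertonDyer.BirchSwinnertonDyer.Theorems.Rank2ShaTierKit3
import Summits.BirchSwinnertonDyer.BirchSwinnertonDyer.Theorems.Rank2ObservatoryPadicAtlasKitOdd
import Summits.BirchSwinnertonDyer.Rank1Residual.X1.PadicSigmaThreeExistence
import HarnessLib

/-!
# BirchSwinnertonDyer — rank-2 `Ш[3^∞]` cell: the READER of frame «finite» at `p = 3`

HONEST FRAMING (cell `b2b-bsdr2sha`, run/shared/lean/b2b/bsd-rank2-sha/): per-pair certified
theorems «cited hypotheses ∧ certified computation ⇒ `Ш(E/ℚ)[p^∞]` finite» for rank-2 curves at good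
ordinary primes; NO claim on BSD in rank `≥ 2`, no class-level theorem, every published input is a
NAMED HYPOTHESIS of the tree (nothing is asserted or minted here).

`Rank2ShaTierBook.lean`'s reader `ShaRow.booked_finite` (frame «finite»: V-FINITE census rows, no image
hypothesis, no order claim) asks `5 ≤ p` through the base test `ShaRow.check` and the observatory's
`padicRow_of_certificate`. The observatory already holds the odd-prime row theorem
`padicRow_of_certificate_odd` (`Rank2ObservatoryPadicAtlasKitOdd.lean`: Perrin-Riou–Schneider at `p > 2`
as printed, `Schneider1985_order_charGenerator_odd`, plus the named existence clause of the Mazur–Tate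
sigma pair at odd `p`, `mazur_tate_sigma_exists_odd`, which supplies THE canonical height datum at `3`).
This file (theorems only; no new object, no axiom) is the `p = 3` twin of the reader, on the `p = 3`
base test `ShaRow.check₃` of `Rank2ShaTierKit3.lean`:

* `ShaRow.finite₃` — from `check₃`, GIVEN `hS`, `hσ`, the newform, Kato's Thm. 17.4 for every cyclotomic
  datum, the rank certificate `2 ≤ rank` and `[T²] L_3 ≠ 0`: `rank_ℤ E(ℚ) = 2`, `ord_{T=0} L_3 = 2`,
  `Ш(E/ℚ)[3^∞]` finite, every canonical `3`-adic height non-degenerate;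
* READER `ShaRow.booked_finite₃` (certificate `R.check₃ = true ∧ 2 ≤ rank`; instances built inside the
  statement) — for the 8 V-FINITE `p = 3` rows of census slice 21.

References: K. Kato, Astérisque 295 (2004), Thm. 17.4 [Kato2004Asterisque]; J. Balakrishnan,
J. S. Müller, W. Stein, Math. Comp. 85 (2016), Thm. 1.7 [BalakrishnanMullerStein2015]; B. Mazur,
W. Stein, J. Tate, Doc. Math. Extra Vol. (2006), Thm. 1.3 [MazurSteinTate2006]; W. Stein, C. Wuthrich,
Math. Comp. 82 (2013), Thm. 6.1 and §8 [SteinWuthrich2013].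
-/

set_option autoImplicit false

-- single-conjunct summit: `Summit.BirchSwinnertonDyer.BirchSwinnertonDyer.…` repeats the name by design
set_option linter.dupNamespace false

noncomputable section

open scoped Classical MatrixGroups ModularForm

open CongruenceSubgroup WeierstrassCurve Literature.NumberTheory.EllipticCurves
  Literature.NumberTheory.EllipticCurves.ModularForms
  Literature.NumberTheory.EllipticCurves.Rank1Residual
  Summit.BirchSwinnertonDyer.BirchSwinnertonDyer.Rank2Observatory

namespace Summit.BirchSwinnertonDyer.BirchSwinnertonDyer.Rank2Sha

namespace ShaRow

variable {R : ShaRow}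

/-- **TIER ROW THEOREM at `p = 3`, frame «finite»** (no image hypothesis, no `a`, `b`): for a compact
row passing `check₃` (`3` good ordinary, minimal model, exact Tamagawa certificate), GIVEN `hS`
(Perrin-Riou–Schneider at `p > 2`), `hσ` (Mazur–Tate sigma existence at odd `p`), the newform `hf`,
Kato's Thm. 17.4 for every cyclotomic datum (`hK`), the rank certificate `hlow : 2 ≤ rank` and
`hLp : [T²] L_3 ≠ 0`: `rank_ℤ E(ℚ) = 2`, `ord_{T=0} L_3 = 2`, `Ш(E/ℚ)[3^∞]` finite, and every canonical
`3`-adic height datum is non-degenerate. Per pair; NOT a class theorem.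
[cite: Kato2004Asterisque, Thm. 17.4 (p. 273)] [cite: BalakrishnanMullerStein2015, Thm. 1.7 and p. 3]
[cite: MazurSteinTate2006, Thm. 1.3] [cite: SteinWuthrich2013, Thm. 6.1 and §8] -/
theorem finite₃ (h : R.check₃ = true) [(R.e.baseChange ℚ).IsElliptic] [(R.e.baseChange ℚ).IsGloballyMinimal]
    (hS : Schneider1985_order_charGenerator_odd) (hσ : mazur_tate_sigma_exists_odd)
    {N : ℕ} [NeZero N] {f : CuspForm (Gamma0 N) 2} (hf : IsNewformOf (R.e.baseChange ℚ) f)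
    (hK : ∀ (κ : ZpExtension ℚ 3) (γ : Field.absoluteGaloisGroup ℚ),
      kato_divisibility (R.e.baseChange ℚ) 3 (κ := κ) (γ := γ) (f := f))
    (hlow : 2 ≤ (R.e.baseChange ℚ).mordellWeilRank)
    (hLp : PowerSeries.coeff 2 (padicLFunction f (unitRoot (R.e.baseChange ℚ) 3 : ℚ_[3])) ≠ 0) :
    (R.e.baseChange ℚ).mordellWeilRank = 2 ∧
      (padicLFunction f (unitRoot (R.e.baseChange ℚ) 3 : ℚ_[3])).order = 2 ∧
      Finite (AddCommGroup.primaryComponent (R.e.baseChange ℚ).sha 3) ∧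
      ∀ Dh : PAdicHeightData (R.e.baseChange ℚ) 3, Dh.IsCanonical → SchneiderConjecture Dh :=
  haveI : Fact (Nat.Prime 3) := ⟨Nat.prime_three⟩
  padicRow_of_certificate_odd hS hσ (R.e.baseChange ℚ) 3 hK (by decide) (isOrdinaryAt₃ h) hf hlow hLp

/-- **READER at `p = 3`, V-FINITE** (no image hypothesis, no `a`, `b`): from `check₃ ∧ 2 ≤ rank`, GIVEN
`hS`, `hσ`, the newform, Kato's Thm. 17.4 for every cyclotomic datum and `[T²] L_3 ≠ 0`: `rank_ℤ E(ℚ) = 2`,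
`ord_{T=0} L_3 = 2`, `Ш(E/ℚ)[3^∞]` finite, every canonical `3`-adic height non-degenerate.
[cite: Kato2004Asterisque, Thm. 17.4 (p. 273)] [cite: BalakrishnanMullerStein2015, Thm. 1.7]
[cite: MazurSteinTate2006, Thm. 1.3] [cite: SteinWuthrich2013, Thm. 6.1 and §8] -/
theorem booked_finite₃ (h : R.check₃ = true ∧ 2 ≤ (R.e.baseChange ℚ).mordellWeilRank) :
    haveI := (isElliptic_and_isGloballyMinimal₃ h.1).1
    haveI := (isElliptic_and_isGloballyMinimal₃ h.1).2
    ∀ (_hS : Schneider1985_order_charGenerator_odd) (_hσ : mazur_tate_sigma_exists_odd)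
      {N : ℕ} [NeZero N] {f : CuspForm (Gamma0 N) 2} (_hf : IsNewformOf (R.e.baseChange ℚ) f)
      (_hK : ∀ (κ : ZpExtension ℚ 3) (γ : Field.absoluteGaloisGroup ℚ),
        kato_divisibility (R.e.baseChange ℚ) 3 (κ := κ) (γ := γ) (f := f))
      (_hLp : PowerSeries.coeff 2 (padicLFunction f (unitRoot (R.e.baseChange ℚ) 3 : ℚ_[3])) ≠ 0),
      (R.e.baseChange ℚ).mordellWeilRank = 2 ∧
        (padicLFunction f (unitRoot (R.e.baseChange ℚ) 3 : ℚ_[3])).order = 2 ∧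
        Finite (AddCommGroup.primaryComponent (R.e.baseChange ℚ).sha 3) ∧
        ∀ Dh : PAdicHeightData (R.e.baseChange ℚ) 3, Dh.IsCanonical → SchneiderConjecture Dh := by
  intro hS hσ N _ f hf hK hLp
  haveI := (isElliptic_and_isGloballyMinimal₃ h.1).1
  haveI := (isElliptic_and_isGloballyMinimal₃ h.1).2
  exact finite₃ h.1 hS hσ hf hK h.2 hLp

/-- **TIER ROW THEOREM at `p = 3`, frame «finite», sigma fact DISCHARGED**: as `finite₃`, with the
Mazur–Tate sigma existence at `3` supplied by the TREE THEOREM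
`Summit.BirchSwinnertonDyer.Rank1Residual.X1.PadicSigmaThree.mazur_tate_sigma_exists_odd_holds`
(Blakestad–Grant Frobenius-lift argument at `p = 3`), so the only named facts left are `hS`
(Perrin-Riou–Schneider at `p > 2`) and Kato's Thm. 17.4 (`hK`). [cite: Kato2004Asterisque, Thm. 17.4 (p. 273)]
[cite: BalakrishnanMullerStein2015, Thm. 1.7 and p. 3] [cite: SteinWuthrich2013, Thm. 6.1 and §8] -/
theorem finite₃' (h : R.check₃ = true) [(R.e.baseChange ℚ).IsElliptic] [(R.e.baseChange ℚ).IsGloballyMinimal]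
    (hS : Schneider1985_order_charGenerator_odd)
    {N : ℕ} [NeZero N] {f : CuspForm (Gamma0 N) 2} (hf : IsNewformOf (R.e.baseChange ℚ) f)
    (hK : ∀ (κ : ZpExtension ℚ 3) (γ : Field.absoluteGaloisGroup ℚ),
      kato_divisibility (R.e.baseChange ℚ) 3 (κ := κ) (γ := γ) (f := f))
    (hlow : 2 ≤ (R.e.baseChange ℚ).mordellWeilRank)
    (hLp : PowerSeries.coeff 2 (padicLFunction f (unitRoot (R.e.baseChange ℚ) 3 : ℚ_[3])) ≠ 0) :
    (R.e.baseChange ℚ).mordellWeilRank = 2 ∧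
      (padicLFunction f (unitRoot (R.e.baseChange ℚ) 3 : ℚ_[3])).order = 2 ∧
      Finite (AddCommGroup.primaryComponent (R.e.baseChange ℚ).sha 3) ∧
      ∀ Dh : PAdicHeightData (R.e.baseChange ℚ) 3, Dh.IsCanonical → SchneiderConjecture Dh :=
  finite₃ h hS Summit.BirchSwinnertonDyer.Rank1Residual.X1.PadicSigmaThree.mazur_tate_sigma_exists_odd_holds
    hf hK hlow hLp

/-- **READER at `p = 3`, V-FINITE, sigma fact DISCHARGED**: from `check₃ ∧ 2 ≤ rank`, GIVEN `hS`, the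
newform, Kato's Thm. 17.4 for every cyclotomic datum and `[T²] L_3 ≠ 0` (no sigma hypothesis):
`rank_ℤ E(ℚ) = 2`, `ord_{T=0} L_3 = 2`, `Ш(E/ℚ)[3^∞]` finite, every canonical `3`-adic height
non-degenerate. [cite: Kato2004Asterisque, Thm. 17.4 (p. 273)] [cite: BalakrishnanMullerStein2015, Thm. 1.7]
[cite: SteinWuthrich2013, Thm. 6.1 and §8] -/
theorem booked_finite₃' (h : R.check₃ = true ∧ 2 ≤ (R.e.baseChange ℚ).mordellWeilRank) :
    haveI := (isElliptic_and_isGloballyMinimal₃ h.1).1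
    haveI := (isElliptic_and_isGloballyMinimal₃ h.1).2
    ∀ (_hS : Schneider1985_order_charGenerator_odd)
      {N : ℕ} [NeZero N] {f : CuspForm (Gamma0 N) 2} (_hf : IsNewformOf (R.e.baseChange ℚ) f)
      (_hK : ∀ (κ : ZpExtension ℚ 3) (γ : Field.absoluteGaloisGroup ℚ),
        kato_divisibility (R.e.baseChange ℚ) 3 (κ := κ) (γ := γ) (f := f))
      (_hLp : PowerSeries.coeff 2 (padicLFunction f (unitRoot (R.e.baseChange ℚ) 3 : ℚ_[3])) ≠ 0),
      (R.e.baseChange ℚ).mordellWeilRank = 2 ∧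
        (padicLFunction f (unitRoot (R.e.baseChange ℚ) 3 : ℚ_[3])).order = 2 ∧
        Finite (AddCommGroup.primaryComponent (R.e.baseChange ℚ).sha 3) ∧
        ∀ Dh : PAdicHeightData (R.e.baseChange ℚ) 3, Dh.IsCanonical → SchneiderConjecture Dh := by
  intro hS N _ f hf hK hLp
  haveI := (isElliptic_and_isGloballyMinimal₃ h.1).1
  haveI := (isElliptic_and_isGloballyMinimal₃ h.1).2
  exact finite₃' h.1 hS hf hK h.2 hLp

end ShaRow

end Summit.BirchSwinnertonDyer.BirchSwinnertonDyer.Rank2Sha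

end
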